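import Literature.AlgebraicGeometry.AbelianSchemes.DualPairOfGluedHatUnique
import Literature.AlgebraicGeometry.AbelianSchemes.RigidifiedTrivialOfOpenCover
import Literature.AlgebraicGeometry.AbelianSchemes.RigidifiedGluingOfCechPic
import HarnessLib

/-!
# (Z3) FILE P-b, letter (E): EXISTENCE of the classifying map into a glued hat with chart data

Layer `Literature/AlgebraicGeometry/AbelianSchemes`, namespace `Literature.AlgebraicGeometry.AbelianSchemes.AbelianSchemeOver`.
THEOREMS ONLY (no definition, no named fact, no instance, no notation, no `sorry`).  Cell hodgecm-mathlib (D-0151), FLOOR 0 P1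
sub-line `Cruxes/HDel/Lines/F3DualAbelianScheme.lean` stub (Z) `stub_F3Z`; FILE P-b letter (E) of the skeleton
`B-provers/B-p06/g14/F3/DualPairOfGluedHat.SKELETON-v3-2sorry.B-p06g14.lean` (B-p06 (g14)), discharged here.

SETTING as in ★-shaped `DualPairOfGluedHatUnique` (hat `H` with cartesian charts `χᵢ`, product charts `Ξᵢ = prodChart i`, chart dual pairs
`Eᵢ`, a module `P′` on `A ×_S H` with `Ξᵢ^*P′ ≅ 𝒫ᵢ`).  [MumfordAV1970, §13, proof of the Thm. p. 125] / [MilneAV2008, I §8 proof of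
Thm. 8.9]: «define the map locally by the universal property of the local duals; the local maps agree on overlaps by uniqueness; the
local isomorphisms of rigidified bundles glue».

* `nonempty_chartSolution_iso` — on the chart `Tᵢ = T ×_S Uᵢ` (`ι : Tᵢ → T`, `t : Tᵢ → Uᵢ`), the composite `gᵢ := γᵢ ≫ χᵢ` of the
  classifying map `γᵢ` of `ℒ|_{Tᵢ}` (read for `Aᵢ` through ★-shaped `RigidifiedLineBundle.toBaseChange`) for the dual pair `Eᵢ` SOLVES
  `(1 × gᵢ)^*P′ ≅ ℒ|_{Tᵢ}` (chart square `bcHomLeft_comp_baseChangeToProd_comp_prodChart'`);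
* `nonempty_solution_iso_transportBase` — bookkeeping: a solution statement over a base map `f₁` transports along an equality `f₁ = f₁′`;
* **`exists_classify_of_charts`** — letter (E): the `gᵢ` agree on `Tᵢ ×_T Tⱼ` (★-shaped letter (U)
  `eq_of_nonempty_pullbackToProd_iso_of_charts` applied to the restricted solutions, ★ `restrictSolutionIso`), glue to `g : T → H`
  (Mathlib `Scheme.Cover.glueMorphisms` on `𝒰.pullback₁ f`), and `(1 × g)^*P′ ≅ ℒ` globally because both are RIGIDIFIED line bundles on
  `A_T` isomorphic on every `A_{Tᵢ}` (★ `RigidifiedTrivialOfOpenCover.nonempty_iso_of_openCover_of_isLocallyNoetherian`; `P′` rigidified ⇒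
  `(1 × g)^*P′` rigidified by ★ `nonempty_pullback_unitSection_baseChangeToProd_iso`).

HC_CM is proved only modulo the 7 printed citations until rung 0 closes; this file discharges none of them (count-neutral capital).

## References
* [MumfordAV1970] D. Mumford, *Abelian Varieties* (1970), §13 (Thm. p. 125 and its proof).
* [MilneAV2008] J. S. Milne, *Abelian Varieties* (v2.00, 2008), I §8 pp. 36–37 (Thm. 8.9 and its proof).
* [GortzWedhorn2020] U. Görtz, T. Wedhorn, *Algebraic Geometry I*, 2nd ed. (2020), Section (3.3) Prop. 3.5 (glueing morphisms).
-/

set_option autoImplicit false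

-- `Scheme.Modules` / the `Over`-structure maps of ★ `baseChange` are not reducible (as in ★ `PoincareUniversalLocality`).
set_option backward.isDefEq.respectTransparency false

noncomputable section

universe u

open CategoryTheory CategoryTheory.Limits AlgebraicGeometry MonoidalCategory
open Literature.AlgebraicGeometry.Motives Literature.AlgebraicGeometry.AbelianVarieties Literature.AlgebraicGeometry.Modules

namespace Literature.AlgebraicGeometry.AbelianSchemes

namespace AbelianSchemeOver

variable {S : Scheme.{u}} (A : AbelianSchemeOver S) (𝒰 : Scheme.OpenCover.{u} S)
  (E : ∀ i, (A.baseChange (𝒰.f i)).DualPair) (H : AbelianSchemeOver S) (χ : ∀ i, (E i).hat.X.left ⟶ H.X.left)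
  (hχ : ∀ i, (E i).hat.IsBaseChangeVia H (𝒰.f i) (χ i))

/-! ### The chart solutions -/

section Chart

variable {A 𝒰 E H χ} {T T₁ : Scheme.{u}} {f : T ⟶ S} (i : 𝒰.I₀) (ι : T₁ ⟶ T) (t : T₁ ⟶ 𝒰.X i)
  (hιt : ι ≫ f = t ≫ 𝒰.f i) (γ : T₁ ⟶ (E i).hat.X.left) (hγt : γ ≫ (E i).hat.X.hom = t)

include hχ hγt in
/-- The base point of `γ ≫ χᵢ`: `(γ ≫ χᵢ) ≫ π_H = t ≫ (Uᵢ → S)`. [cite: MumfordFogartyKirwan1994, Ch. 7 §2 Definition 7.2 (p. 129)] -/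
theorem comp_chart_comp_hom : (γ ≫ χ i) ≫ H.X.hom = t ≫ 𝒰.f i := by
  have w : χ i ≫ H.X.hom = (E i).hat.X.hom ≫ 𝒰.f i := (hχ i).fst
  rw [Category.assoc, w, ← Category.assoc, hγt]

/-- **Chart square, chart-solution form**: `e ≫ (1 × γ) ≫ Ξᵢ = 1 × (γ ≫ χᵢ)` as maps `A_{t ≫ (Uᵢ → S)} → A ×_S H` (`e` = ★ `bcHomLeft`).
[cite: GortzWedhorn2020, Prop. 4.16 (p. 101)] -/
theorem bcHomLeft_comp_baseChangeToProd_comp_prodChart' :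
    A.bcHomLeft (𝒰.f i) t ≫ (A.baseChange (𝒰.f i)).baseChangeToProd (E i).hat t γ hγt ≫ A.prodChart 𝒰 E H χ hχ i =
      A.baseChangeToProd H (t ≫ 𝒰.f i) (γ ≫ χ i) (comp_chart_comp_hom hχ i t γ hγt) := by
  apply pullback.hom_ext
  · rw [Category.assoc, Category.assoc, prodChart_fst, baseChangeToProd_fst_assoc, baseChangeToProd_fst]
    exact A.baseChangeCompGrpIso_hom_left_fst_fst (𝒰.f i) t
  · rw [Category.assoc, Category.assoc, prodChart_snd, baseChangeToProd_snd_assoc, baseChangeToProd_snd]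
    exact A.baseChangeCompGrpIso_hom_left_snd_assoc (𝒰.f i) t (γ ≫ χ i)

/-- **The chart solution**: if `Ξᵢ^*P′ ≅ 𝒫ᵢ` and `γ` classifies the family `ℒ|_{T₁}` read for `Aᵢ` (`(1 × γ)^*𝒫ᵢ ≅ ((ℒ.comapAlong ι).toBaseChange).L`),
then `gᵢ := γ ≫ χᵢ` solves `(1 × gᵢ)^*P′ ≅ (ℒ.comapAlong ι).L` over the base `t ≫ (Uᵢ → S)`. [cite: MilneAV2008, I §8 pp. 36–37] -/
theorem nonempty_chartSolution_iso (P' : (A.prodLeft H).Modules)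
    (hPi : Nonempty ((Scheme.Modules.pullback (A.prodChart 𝒰 E H χ hχ i)).obj P' ≅ (E i).P)) (ℒ : A.RigidifiedLineBundle f)
    (hγ : Nonempty ((E i).pullbackP t γ hγt ≅ ((ℒ.comapAlong ι hιt).toBaseChange).L)) :
    Nonempty ((Scheme.Modules.pullback (A.baseChangeToProd H (t ≫ 𝒰.f i) (γ ≫ χ i) (comp_chart_comp_hom hχ i t γ hγt))).obj P' ≅
      (ℒ.comapAlong ι hιt).L) := by
  obtain ⟨c⟩ := hPi
  obtain ⟨k⟩ := ((ℒ.comapAlong ι hιt).nonempty_iso_toBaseChange_L_iff _).1 hγ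
  -- `(1 × gᵢ)^*P′ ≅ (e ≫ (1 × γ) ≫ Ξᵢ)^*P′ ≅ e^* (1 × γ)^* Ξᵢ^* P′ ≅ e^* (1 × γ)^* 𝒫ᵢ ≅ (ℒ.comapAlong ι).L`
  exact ⟨(Scheme.Modules.pullbackCongr (bcHomLeft_comp_baseChangeToProd_comp_prodChart' hχ i t γ hγt).symm).app P' ≪≫
    ((Scheme.Modules.pullbackComp _ _).app P').symm ≪≫
    (Scheme.Modules.pullback (A.bcHomLeft (𝒰.f i) t)).mapIso
      (((Scheme.Modules.pullbackComp _ _).app P').symm ≪≫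
        (Scheme.Modules.pullback ((A.baseChange (𝒰.f i)).baseChangeToProd (E i).hat t γ hγt)).mapIso c) ≪≫ k⟩

end Chart

/-- Bookkeeping: a solution statement `(1 × g)^*P′ ≅ (1 × w)^*ℒ` over a base map `f₁` transports along an equality `f₁ = f₁′` of base
maps (the source schemes `A_{f₁}`, `A_{f₁′}` agree only propositionally). [cite: GortzWedhorn2020, Section (4.7) (pp. 107–108)] -/
theorem nonempty_solution_iso_transportBase (P' : (A.prodLeft H).Modules) {T T₁ : Scheme.{u}} {f : T ⟶ S} (L : (A.baseChange f).X.left.Modules)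
    (w : T₁ ⟶ T) (g : T₁ ⟶ H.X.left) {f₁ f₁' : T₁ ⟶ S} (e : f₁ = f₁') (hw : w ≫ f = f₁) (hg : g ≫ H.X.hom = f₁)
    (h : Nonempty ((Scheme.Modules.pullback (A.baseChangeToProd H f₁ g hg)).obj P' ≅
      (Scheme.Modules.pullback (A.prodMap f₁ f w hw)).obj L)) :
    Nonempty ((Scheme.Modules.pullback (A.baseChangeToProd H f₁' g (hg.trans e))).obj P' ≅
      (Scheme.Modules.pullback (A.prodMap f₁' f w (hw.trans e))).obj L) := by
  subst e
  exact h

/-! ### Letter (E): existence of the classifying map -/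

/-- **Letter (E) — EXISTENCE OF THE CLASSIFYING MAP INTO A GLUED HAT** ([MumfordAV1970, §13 p. 125]; [MilneAV2008, I §8 Thm. 8.9]):
for `P′` on `A ×_S H` rigidified along `ε_A × 1_H` with `Ξᵢ^*P′ ≅ 𝒫ᵢ` for all `i`, and a rigidified fibrewise-`Pic⁰` line bundle `ℒ` on
`A_T` (`f : T → S`), there is an `S`-morphism `g : T → H` with `(1 × g)^*P′ ≅ ℒ`.  PROOF: on `Tᵢ = T ×_S Uᵢ` classify `ℒ|_{Tᵢ}` (read for
`Aᵢ`, ★-shaped `toBaseChange`) by `Eᵢ` and compose with `χᵢ` (`nonempty_chartSolution_iso`); on `Tᵢ ×_T Tⱼ` the two candidates solve the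
same problem (★ `restrictSolutionIso`) hence agree (letter (U)); glue (Mathlib `Scheme.Cover.glueMorphisms`); the glued `(1 × g)^*P′` and `ℒ`
are rigidified line bundles isomorphic on every `A_{Tᵢ}`, hence isomorphic (★ `nonempty_iso_of_openCover_of_isLocallyNoetherian`).
[cite: MumfordAV1970, §13 (p. 125)] [cite: MilneAV2008, I §8 pp. 36–37] [cite: GortzWedhorn2020, Section (3.3) Proposition 3.5] -/
theorem exists_classify_of_charts [IsLocallyNoetherian S] (P' : (A.prodLeft H).Modules) (h1 : HasRank P' 1)
    (hrig : Nonempty ((Scheme.Modules.pullback (A.unitSlice H)).obj P' ≅ SheafOfModules.unit _))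
    (hP : ∀ i, Nonempty ((Scheme.Modules.pullback (A.prodChart 𝒰 E H χ hχ i)).obj P' ≅ (E i).P))
    {T : Scheme.{u}} (f : T ⟶ S) (ℒ : A.RigidifiedLineBundle f) (hℒ : ℒ.FibrewisePicZero) :
    ∃ (g : T ⟶ H.X.left) (hg : g ≫ H.X.hom = f),
      Nonempty ((Scheme.Modules.pullback (A.baseChangeToProd H f g hg)).obj P' ≅ ℒ.L) := by
  -- the charts `Tᵢ = T ×_S Uᵢ` of `T`
  let 𝒱 := 𝒰.pullback₁ f
  let ι : ∀ i : 𝒰.I₀, pullback f (𝒰.f i) ⟶ T := fun i => pullback.fst f (𝒰.f i)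
  let t : ∀ i : 𝒰.I₀, pullback f (𝒰.f i) ⟶ 𝒰.X i := fun i => pullback.snd f (𝒰.f i)
  have hιt : ∀ i, ι i ≫ f = t i ≫ 𝒰.f i := fun i => pullback.condition
  -- the chart families and their classifying maps for `Eᵢ`
  let ℒc : ∀ i, (A.baseChange (𝒰.f i)).RigidifiedLineBundle (t i) := fun i => (ℒ.comapAlong (ι i) (hιt i)).toBaseChange
  have hℒc : ∀ i, (ℒc i).FibrewisePicZero := fun i =>
    RigidifiedLineBundle.toBaseChange_fibrewisePicZero (RigidifiedLineBundle.comapAlong_fibrewisePicZero hℒ (ι i) (hιt i))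
  let γ : ∀ i, pullback f (𝒰.f i) ⟶ (E i).hat.X.left := fun i => (E i).classify (t i) (ℒc i) (hℒc i)
  have hγt : ∀ i, γ i ≫ (E i).hat.X.hom = t i := fun i => (E i).classify_comp_hom (t i) (ℒc i) (hℒc i)
  let gc : ∀ i, pullback f (𝒰.f i) ⟶ H.X.left := fun i => γ i ≫ χ i
  have hgc : ∀ i, gc i ≫ H.X.hom = t i ≫ 𝒰.f i := fun i => comp_chart_comp_hom hχ i (t i) (γ i) (hγt i)
  have hgc' : ∀ i, gc i ≫ H.X.hom = ι i ≫ f := fun i => (hgc i).trans (hιt i).symm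
  -- the chart solutions, over the base `t ≫ (Uᵢ → S)` and over `ι ≫ f`
  have sol : ∀ i, Nonempty ((Scheme.Modules.pullback (A.baseChangeToProd H (t i ≫ 𝒰.f i) (gc i) (hgc i))).obj P' ≅
      (Scheme.Modules.pullback (A.prodMap (t i ≫ 𝒰.f i) f (ι i) (hιt i))).obj ℒ.L) := fun i =>
    nonempty_chartSolution_iso hχ i (ι i) (t i) (hιt i) (γ i) (hγt i) P' (hP i) ℒ
      ((E i).nonempty_pullbackP_classify_iso (t i) (ℒc i) (hℒc i))
  have sol' : ∀ i, Nonempty ((Scheme.Modules.pullback (A.baseChangeToProd H (ι i ≫ f) (gc i) (hgc' i))).obj P' ≅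
      (Scheme.Modules.pullback (A.prodMap (ι i ≫ f) f (ι i) rfl)).obj ℒ.L) := fun i =>
    A.nonempty_solution_iso_transportBase H P' ℒ.L (ι i) (gc i) (hιt i).symm (hιt i) (hgc i) (sol i)
  -- agreement on `Tᵢ ×_T Tⱼ` by letter (U)
  have hagree : ∀ i j, pullback.fst (𝒱.f i) (𝒱.f j) ≫ gc i = pullback.snd (𝒱.f i) (𝒱.f j) ≫ gc j := by
    intro i j
    let w₁ : pullback (𝒱.f i) (𝒱.f j) ⟶ pullback f (𝒰.f i) := pullback.fst (𝒱.f i) (𝒱.f j)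
    let w₂ : pullback (𝒱.f i) (𝒱.f j) ⟶ pullback f (𝒰.f j) := pullback.snd (𝒱.f i) (𝒱.f j)
    have hw : w₁ ≫ ι i = w₂ ≫ ι j := pullback.condition
    have hw₁ : w₁ ≫ ι i ≫ f = (w₁ ≫ ι i) ≫ f := (Category.assoc _ _ _).symm
    have hw₂ : w₂ ≫ ι j ≫ f = (w₁ ≫ ι i) ≫ f := by rw [← Category.assoc, ← hw]
    -- both restricted candidates solve `(1 × ?)^*P′ ≅ ℒ|_W` with `ℒ|_W := ℒ.comapAlong (w₁ ≫ ιᵢ)`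
    have e₁ : Nonempty ((Scheme.Modules.pullback (A.baseChangeToProd H ((w₁ ≫ ι i) ≫ f) (w₁ ≫ gc i)
        (by rw [Category.assoc, hgc' i, Category.assoc]))).obj P' ≅ (ℒ.comapAlong (w₁ ≫ ι i) rfl).L) := by
      obtain ⟨s⟩ := sol' i
      exact ⟨A.restrictSolutionIso H P' w₁ hw₁ (hgc' i) s ≪≫ (Scheme.Modules.pullbackComp _ _).app ℒ.L ≪≫
        (Scheme.Modules.pullbackCongr (A.prodMap_comp ((w₁ ≫ ι i) ≫ f) (ι i ≫ f) f w₁ hw₁ (ι i) rfl)).app ℒ.L⟩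
    have e₂ : Nonempty ((Scheme.Modules.pullback (A.baseChangeToProd H ((w₁ ≫ ι i) ≫ f) (w₂ ≫ gc j)
        (by rw [Category.assoc, hgc' j, ← Category.assoc, ← hw, Category.assoc]))).obj P' ≅
        (ℒ.comapAlong (w₁ ≫ ι i) rfl).L) := by
      obtain ⟨s⟩ := sol' j
      exact ⟨A.restrictSolutionIso H P' w₂ hw₂ (hgc' j) s ≪≫ (Scheme.Modules.pullbackComp _ _).app ℒ.L ≪≫
        (Scheme.Modules.pullbackCongr ((A.prodMap_comp ((w₁ ≫ ι i) ≫ f) (ι j ≫ f) f w₂ hw₂ (ι j) rfl).trans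
          (A.prodMap_congr _ _ hw.symm _ _))).app ℒ.L⟩
    exact A.eq_of_nonempty_pullbackToProd_iso_of_charts 𝒰 E H χ hχ P' hP ((w₁ ≫ ι i) ≫ f) (ℒ.comapAlong (w₁ ≫ ι i) rfl)
      (RigidifiedLineBundle.comapAlong_fibrewisePicZero hℒ _ rfl) _ _ _ _ e₁ e₂
  -- glue
  let g : T ⟶ H.X.left := Scheme.Cover.glueMorphisms 𝒱 gc hagree
  have hgι : ∀ i, ι i ≫ g = gc i := fun i => Scheme.Cover.ι_glueMorphisms 𝒱 gc hagree i
  have hg : g ≫ H.X.hom = f := by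
    refine Scheme.Cover.hom_ext 𝒱 _ _ fun (i : 𝒰.I₀) => ?_
    show ι i ≫ g ≫ H.X.hom = ι i ≫ f
    rw [← Category.assoc, hgι i, hgc' i]
  refine ⟨g, hg, ?_⟩
  -- `(1 × g)^*P′` is a rigidified line bundle on `A_T`; it agrees with `ℒ` on every `A_{Tᵢ}`
  let M : A.RigidifiedLineBundle f :=
    { L := (Scheme.Modules.pullback (A.baseChangeToProd H f g hg)).obj P'
      hasRank_one := hasRank_pullback _ h1
      rigid := A.nonempty_pullback_unitSection_baseChangeToProd_iso H P' f g hg hrig }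
  refine RigidifiedLineBundle.nonempty_iso_of_openCover_of_isLocallyNoetherian M ℒ 𝒱 fun i => ?_
  obtain ⟨s⟩ := sol' i
  -- `(1 × ιᵢ)^* (1 × g)^* P′ ≅ (1 × (ιᵢ ≫ g))^* P′ = (1 × gᵢ)^* P′ ≅ (1 × ιᵢ)^* ℒ`
  exact ⟨(A.restrictSolutionIso H P' (ι i) rfl hg (Iso.refl _)).symm ≪≫
    (Scheme.Modules.pullbackCongr (A.baseChangeToProd_congr H (ι i ≫ f) (hgι i) _ (hgc' i))).app P' ≪≫ s⟩

end AbelianSchemeOver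

end Literature.AlgebraicGeometry.AbelianSchemes

end
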